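import Summits.Ventures.HSemireg.Pad4TowerXStaticSafe2

/-!
# Venture HSemireg — PAD-4 on 𝔅(μ₄): the W-SEARCH encoder's four STATIC INSTANCE FAMILIES `X−`, `X+`, `A2I−`, `A2I+`
# (xres2s.py v19, TIGHT=2 ∕ HBPX ∕ A2IPRES ∕ A1W as fired) as finite decidable closedness predicates — DEF-ONLY + probes
# (bc5-plan g7 LINE 5 SEED TEMPLATE v0.1 §1, definition requests (D-Xfam) ∕ (D-A2Ifam))

HONEST FRAMING. Lean index of the computation cell `pub-hsemireg` (S4-PUSH, H2 door PAD-4), typed by the Ventures-side typer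
`hodge-lit-semireg-typer-2` (g6; line of record stmt-HodgeConjecture-18881 `Cruxes/BlochSeedDiscOne/Lines/birth.lean` 814a6a70c14e831a,
stub `stub_rung_pad4_seedAt`). WHAT THIS FILE IS: the four droppable STATIC families of the cell's W-SEARCH SAT games — the clause families
the encoder of record `xres2s.py` v19 c7ee80d7dccc0bfd (s4push∕search-1∕code∕g24∕wg1∕) emits under the flags of the attribution runs j302131 ∕
j305149 (`run_famcore.sh`: `JOB_TIGHT=2 JOB_HBPX=1 JOB_A2I=1 JOB_DUAL=1 JOB_A2IPRES=1 JOB_A1W=1 JOB_ORBIT=g1`): **`X−`** = `gen_instances_w` +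
`esc_tight2_w` in the original world (participant-exact E₋ instances of LEMMA X-PHASE, PAD4-BALANCED §22), **`X+`** = the same in the DUAL
world (`make_world(dual=True)`: letters `(α, β) ↦ (−α, −β)`, sides `N ↔ P`), **`A2I−`** = `gen_a2i_w` (the single-partner, one-clean-server
instance of LEMMA A∪2I′, §17, CLEAN SUFFICIENT FORM, `|W| ≤ 1` reading `A1W=1`, presence-based applicability `A2IPRES=1`), **`A2I+`** = its
dual — each typed LITERALLY, clause for clause, as «no instance FIRES on the support»: a clause `¬Z ∨ ¬q ∨ ¬n ∨ ⋁ escapes` (`inst_line`) is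
violated on a support `S` iff its head `Z`, partner `q` and server `n` are present and none of its escape classes is (`check` mode, l.676:
`i in S and q in S and n in S and not any(e in S for e in esc)`). PURPOSE: bc5-plan g7's LINE 5 SEED TEMPLATE (`work/g7/LINE5-SEEDS-TEMPLATE.md`
35a591490aa3302d) §1 lists `(D-Xfam)∕(D-A2Ifam)` — «the encoder's four instance families X−, X+, A2I−, A2I+ as closedness predicates» — as the
definition requests its K-free seed statements (B1)∕(B2) need on the hypothesis side `StaticH H C = RuleDMu4Closed C ∧ ⋀_{F ∈ H} FClosed C`,
`H ⊆ {FC1, X−, X+, A2I−, A2I+}` being decided by the family-deletion run LINE 5 (i) (director-hodge g13 R13.43 (2), R13.48; job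
`W-CORE-FAM-D8-G1-v19`). `RuleDMu4Closed` is `Pad4TowerRuleDMu4`, `FC1Mu4Closed` is typed separately; this file supplies the other four.

RELATION TO THE TYPED PENCIL PREDICATES (all differences are the ENCODER's, kept verbatim; «the encoder kills more» in each case).
* X: `Pad4TowerXStaticSafe2.XInstP C Z σ u f` (xgen.py reading p) fires when `W_f(Z) = ∅` and EVERY present `u`-partner of `Z` on `σ` is
  pinned (sibling `n` in a direction `w ≠ u`, no `w`-companion below `n`, (H-e′) and (H-b) participant-exact). xres2s emits one clause PER
  `(q, n, f)` whose escapes are the SHALLOWER `u`-partners (`inter`), the companions (`comp`) and the same three breaker sets (`esc_tight2_w`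
  = `HeOkP`, `HbOkP` with `HBPX`, `WfEmpty` negated): it fires as soon as the TOPMOST present `u`-partner is pinned. PROVED here:
  `xresXFires_of_xInstP` (an xgen reading-p instance yields a firing xres2s clause at the topmost partner), hence
  `not_xInstP_of_xresXClosed` (an `X−`-closed support carries no reading-p instance). The converse is not claimed.
* A2I: `Pad4TowerA2IMu4.A2IDeadMu4Line` (apex `f″`, `W = ∅`, line states for all partners) is the pencil's clean form; xres2s's instance is:
  head `Z ∈ N` with `Z_σ` charged, `u` = ITS OWN PHASE direction (`udir`, sign-flipped in the dual world: `EncDir`), ONE `u`-partner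
  `q = Z − d·n_u^{(σ)} ∈ P` with the GUARD E-A2I-1 `d ≤ c_σ(Z)` in the original world (own ray down to the node, s4-ref g77), any `f′ ≠ σ`
  (apex or not), ONE server `N′ = q + e·n_v^{(f′)} ∈ N`; escapes = a partner of `Z` on `σ` in another direction (`A2IPRES`), a shallower
  `u`-partner (`inter`), a `P` on the `u`-line strictly below `q` (`deeper`, species (3a) not certified), a below-partner of `Z` on `f′` (leg or
  (r2a)) whose `f′`-direction is NOT `v` (`A1W=1`: the `|W| ≤ 1` form), and the polluters of species (3b) (null-lifted along `v`, `1 ≤ e″ ≤ e`)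
  and (3d) (spacelike-lifted, `≤ N′_{f′}`) with `σ`-letter on the `u`-line at or below `q_σ` (census (C2), «whole u-line»).
* Heads: with `JOB_ORBIT=g1` the encoder emits clauses headed at `G₁ = ⟨Δ⟩ × S₄`-orbit REPRESENTATIVES and maps literals to orbit variables;
  the predicates here quantify over ALL present `N`-cells — the same condition on a support whose two levels are `G₁`-closed (the clause
  families are `G₁`-covariant: directions `u, w, v` range over all four phases, the guard and `EncDir` read `α` and `|β|` only), which is the
  only kind of support a LINE 5 statement quantifies over (`PermClosed`, `DeltaClosed` hypotheses). FLAG H-1: this equivalence is the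
  encoder's covariance remark (v18 header), not a theorem of this file.
* Scope: `EncDir`∕the guard agree with `udir`∕`cabs` on μ₄ letters (`β` on an axis), i.e. on every letter of every universe of record
  (◇₆ ∕ ◇₈ ∕ ◇₁₀, `Pad4TowerDiamondMu4.InDiamond`); on a non-μ₄ point `EncDir` holds for no direction (FLAG E-1; the encoder is never run there).
  The search caps `d, e, k < 14` never bind in `◇_h`, `h ≤ 10` (α-differences `≤ h`) and are dropped.

EVIDENCE that the typed predicates ARE the encoder's families (this typer, offline, seconds; scripts and outputs in the staging directory
`s4push/lit-semireg/staging/hodge-lit-semireg-typer-2/g6/xcheck/`): `xres_mirror.py` 251e52538a22b827 = the bodies of `gen_instances_w`,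
`esc_tight2_w`, `gen_a2i_w` and their helpers copied VERBATIM from xres2s.py v19; `driver.py` a4660331768d908b builds a toy alphabet (types
`0.0, 0.1, 0.2, 2.0, 2.1`, 14 letters, pool = all `2·14⁴` classes, HBPX ∕ A2IPRES ∕ A1W on, both worlds via `make_world`'s code), draws random
supports of `≤ 7` cells around a random instance (head, partner, server, a random subset of its escapes, noise), evaluates the encoder's own
check-mode verdict per family, and replays each as a `decide +kernel` probe of `XMinusClosed ∕ XPlusClosed ∕ A2IMinusClosed ∕ A2IPlusClosed`:
**40 supports × 4 families = 160 verdicts, 160 agree, 0 differ** (fires: X− 14, X+ 9, A2I− 9, A2I+ 8; samples `samples-seed11.json`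
21b7b5fa1f5b6c15, `samples-seed23.json` ac5cbdabff2efef9; farm-checked scratch files `XcheckScratch.lean` edcc517278504810 rc 0 44 s,
`XcheckScratch2.lean` 6ac272edb9cb66b6 rc 0 65 s); two of the samples (an `X+` fire and an `A2I+` fire) are shipped in §5.

CONTENT (DEF-ONLY + two small theorems + `decide` probes; nothing about designs is claimed).
* §1 `cabs`, `EncDir`, `Spacelike`, `OnULineBelowEq`; the dual world is `Pad4TowerRuleDMu4Dual.MConfig.dual 0` (`(α, β) ↦ (−α, −β)`, `N ↔ P`).
* §2 **`XresXFires C Z q n σ u w f`** (one `X` clause violated), **`XresXClosed C`**, **`XMinusClosed C := XresXClosed C`**,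
  **`XPlusClosed C := XresXClosed (C.dual 0)`**; `xresXFires_of_xInstP`, `not_xInstP_of_xresXClosed`, `xPlusClosed_dual`.
* §3 **`XresA2IFires C Z q N′ σ u f′ v`**, **`XresA2IClosed C`**, **`A2IMinusClosed`**, **`A2IPlusClosed`**; `a2iPlusClosed_dual`.
* §4 `XresFourClosed C` (the conjunction of the four) — the `⋀_{F ∈ H}` of `StaticH` for `H ⊇ {X±, A2I±}` minus RULE D ∕ FC1.
* §5 probes (`decide`): §22's instrumented column `j275278Column` fires `X−`; s4-ref g72's witness W1 is `X−`-closed exactly through the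
  (H-e′) breaker (and fires without it); the D_ML8 pattern fires `A2I−`; the `A1W` subtlety on `[2I|ℓ₁|O|O]` (a below-partner in the
  server's own direction does NOT save, one in another direction does; the server's own instance is saved by a (3b) polluter); two
  cross-check samples (an `X+` fire, an `A2I+` fire).

WHAT IS NOT HERE ∕ NOT IN LEAN. No LINE 5 statement (bc5-plan drafts it after (i); this file only supplies predicates it may name), no SAT
verdict, no claim that these families are sound kills (their pencil meaning is §22 ∕ §17 + the encoder's ×2 reads, cited), no `FC1`, no RULE D,
no FC-CORE ∕ Ψ (the (H1) side: `Pad4TowerFCCoreSigns`, `Pad4TowerPsiSubA1`), no orbit machinery. NOTHING HERE SAYS THAT HC ∕ HC_CM ∕ HC_AV ∕ W₆ ∕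
HC_Kum4Type HOLDS OR FAILS. No `instance`, no notation, no named fact, 0 `sorry`; axioms standard.

SOURCES (sha16 ∕ bus): xres2s.py v19 c7ee80d7dccc0bfd (`gen_instances_w` l.473–504, `esc_tight2_w` l.454–472, `gen_a2i_w` l.506–605,
`make_world` l.444–453, `inst_line` l.612–618, check mode l.676–699, GUARD E-A2I-1 comment (s4-ref g77 ×2 0934e975a1632699), v18 header
(A2IPRES, HBPX, covariance)); bc5-plan g7 `kit-famcore/run_famcore.sh` 304a09a89a281797 (flags of record) and LINE5-SEEDS-TEMPLATE.md
35a591490aa3302d §1–§2 (cell INBOX l.32395); director-hodge g13 R13.43 (2)(3) l.32380, R13.48; `Pad4TowerXStaticSafe2.lean` (tree; `NullBelow`,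
`WfEmpty`, `HeOkP`, `HbOkP`, `XInstP`), `Pad4TowerRuleDMu4Dual.lean` (`dualPt`, `MConfig.dual`, `dual_dual`), `Pad4TowerA2IMu4.lean` (`Timelike`,
the D_ML8 probe cells), `Pad4TowerCrossPhase.lean` (`UPartner`, `Sibling`, `NoCompanion`, the §22 probe configurations). -/

namespace Summit.Ventures.HSemireg.Pad4Tower

open Finset

/-! ## §1 Encoder geometry: `cabs`, the partner direction `EncDir`, spacelike offsets, the `u`-line -/

/-- the encoder's `cabs(p) = max(|Re β|, |Im β|)` (= the charge `c` of a μ₄ letter `t·I + c·ℓ_u`). -/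
abbrev cabs (x : BPoint) : ℤ := max |x.2.1| |x.2.2|

/-- **the encoder's partner direction `u` of a charged letter** (`gen_a2i_w`: `u = udir(Z_σ)` if `α ≥ 0`, `−udir(Z_σ)` if `α < 0`, with
`udir(p) = β∕cabs(p)`): in the original world (`α ≥ 0`) `x` is the letter `(α − c)·I + c·ℓ_u` and its partners `x − d·n_u` run down its OWN
ray towards its node; in the dual world (`α < 0`, letters negated) the flipped sign makes `x − d·n_u` run away from the (negated) node, i.e.
the duals of the original letter's HIGHER own-ray neighbours. Holds for no `u` at a non-μ₄ point (FLAG E-1). Decidable. -/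
abbrev EncDir (x : BPoint) (u : Fin 4) : Prop :=
  (0 ≤ x.1 ∧ x = ray (x.1 - cabs x, 0, 0) u (cabs x)) ∨ (x.1 < 0 ∧ x = ray (x.1 + cabs x, 0, 0) u (-(cabs x)))

/-- a SPACELIKE offset (encoder `spacelike`: `Δα² < |Δβ|²`). -/
abbrev Spacelike (Δ : BPoint) : Prop := Δ.1 ^ 2 < Δ.2.1 ^ 2 + Δ.2.2 ^ 2

/-- `x` lies on the `u`-line AT OR BELOW `y`: `y = x + e′·n_u`, `e′ ≥ 0` (encoder `uline`: `q_σ − e′·n_u`, `e′ = 0, 1, …`). -/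
abbrev OnULineBelowEq (x y : BPoint) (u : Fin 4) : Prop := x.1 ≤ y.1 ∧ y = ray x u (y.1 - x.1)

/-! ## §2 The `X` family (`gen_instances_w` + `esc_tight2_w`, TIGHT=2, HBPX=1): `X−` on `C`, `X+` on the dual -/

/-- **ONE `X` CLAUSE FIRES**: the clause of the instance `(Z; σ, u; q; w, n; f)` is violated on the support `C` — head `Z` with `Z_σ`
charged, `f ≠ σ`; `q ∈ E₊` a `u`-partner of `Z` on `σ` that is the TOPMOST present one (escape set `inter` empty); `n ∈ E₋` a sibling of `q`
in a direction `w ≠ u` with no `w`-companion strictly between (`comp` empty); and none of the participant-exact breakers present: (H-e′)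
(`HeOkP`: every present `Z(σ ↦ y)` with `y ≤ n_σ`, `y − Z_σ` not timelike lies in `q_σ + C̄⁺`), (H-b) with `HBPX` (`HbOkP`), and
`W_f(Z) = ∅` (`WfEmpty`: no leg of `Z` on `f`, no (r2a) partner touching `f`) — `esc_tight2_w` negated term by term. Decidable. -/
abbrev XresXFires (C : MConfig) (Z q n : MCell) (σ u w f : Fin 4) : Prop :=
  ¬ isApex (Z σ) ∧ f ≠ σ ∧ UPartner Z q σ u ∧ (∀ P ∈ C.upper, UPartner Z P σ u → (P σ).1 ≤ (q σ).1) ∧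
    w ≠ u ∧ Sibling q n σ w ∧ NoCompanion C q n σ w ∧ HeOkP C Z q n σ ∧ HbOkP C Z n σ f ∧ WfEmpty C Z f

/-- **THE `X` FAMILY IS CLOSED on `C`** (no clause of `gen_instances_w` is violated): for every present head `Z ∈ E₋`, partner `q ∈ E₊`
and sibling `n ∈ E₋` and all `(σ, u, w, f)`, the clause does not fire. Decidable. -/
abbrev XresXClosed (C : MConfig) : Prop :=
  ∀ Z ∈ C.lower, ∀ q ∈ C.upper, ∀ n ∈ C.lower, ∀ σ u w f : Fin 4, ¬ XresXFires C Z q n σ u w f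

/-- **`X−`-CLOSED** = the original-world family (`make_world(False)`, E₋ columns). -/
abbrev XMinusClosed (C : MConfig) : Prop := XresXClosed C

/-- **`X+`-CLOSED** = the dual-world family (`make_world(True)`: letters `(α, β) ↦ (−α, −β)` = `dualPt 0`, sides swapped =
`MConfig.dual 0`; E₊ columns). -/
abbrev XPlusClosed (C : MConfig) : Prop := XresXClosed (C.dual 0)

/-- `X+` of the dual is `X−` (the dual is an involution, `Pad4TowerRuleDMu4Dual.dual_dual`). -/
theorem xPlusClosed_dual (C : MConfig) : XPlusClosed (C.dual 0) ↔ XMinusClosed C := by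
  rw [XPlusClosed, dual_dual]

/-- **AN xgen READING-p INSTANCE YIELDS A FIRING xres2s CLAUSE** («the encoder kills more»): if `XInstP C Z σ u f` holds (`W_f(Z) = ∅` and
every present `u`-partner pinned), then the clause at the TOPMOST present `u`-partner and its pinning sibling fires. -/
theorem xresXFires_of_xInstP {C : MConfig} {Z : MCell} {σ u f : Fin 4} (h : XInstP C Z σ u f) :
    ∃ q ∈ C.upper, ∃ n ∈ C.lower, ∃ w : Fin 4, XresXFires C Z q n σ u w f := by
  obtain ⟨hch, hσf, ⟨q₀, hq₀, hq₀Z⟩, hW, hpin⟩ := h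
  -- the topmost present `u`-partner: maximise the `σ`-height over the present partners
  obtain ⟨q, hq, hmax⟩ := (C.upper.filter fun P => UPartner Z P σ u).exists_max_image (fun P => (P σ).1)
    ⟨q₀, Finset.mem_filter.2 ⟨hq₀, hq₀Z⟩⟩
  obtain ⟨hqU, hqZ⟩ := Finset.mem_filter.1 hq
  obtain ⟨n, hn, w, hw, hsib, hcomp, hhe, hhb⟩ := hpin q hqU hqZ
  exact ⟨q, hqU, n, hn, w, hch, Ne.symm hσf, hqZ, fun P hP hPZ => hmax P (Finset.mem_filter.2 ⟨hP, hPZ⟩), hw, hsib, hcomp,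
    hhe, hhb, hW⟩

/-- hence an `X−`-CLOSED support carries NO reading-p instance (`Pad4TowerXStaticSafe2.XInstP`) at any present `N`-cell. -/
theorem not_xInstP_of_xresXClosed {C : MConfig} (h : XresXClosed C) {Z : MCell} (hZ : Z ∈ C.lower) (σ u f : Fin 4) :
    ¬ XInstP C Z σ u f := fun hI => by
  obtain ⟨q, hq, n, hn, w, hf⟩ := xresXFires_of_xInstP hI
  exact h Z hZ q hq n hn σ u w f hf

/-! ## §3 The `A2I` family (`gen_a2i_w`, A2IPRES=1, A1W=1, GUARD E-A2I-1): `A2I−` on `C`, `A2I+` on the dual -/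

/-- **ONE `A2I` CLAUSE FIRES**: the clause of the instance `(Z; σ, u; q; f′, v, N′)` is violated on `C` — head `Z` with `Z_σ` charged and
`u` its encoder direction; `q ∈ E₊` a `u`-partner at depth `d = α(Z_σ) − α(q_σ)` obeying the GUARD (original world `α ≥ 0`: `d ≤ cabs`);
`f′ ≠ σ`; `N′ ∈ E₋` the server `q + e·n_v^{(f′)}`; and no escape present: no partner of `Z` on `σ` in another direction (`A2IPRES`), no
shallower `u`-partner (`inter`), no `P` on the `u`-line strictly below `q` (`deeper`), no below-partner of `Z` on `f′` (leg `Z(f′ ↦ y)` or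
(r2a) `Z(f′ ↦ y, g ↦ y′)`, strictly null-below) whose `f′`-direction differs from `v` (`A1W`), and no polluter of `N′`'s row with the other
letters those of `Z`, `σ`-letter on the `u`-line at or below `q_σ`, and `f′`-letter null-lifted along `v` by `1 … e` (species (3b)) or
spacelike-lifted and `≤ N′_{f′}` (species (3d)). Decidable. -/
abbrev XresA2IFires (C : MConfig) (Z q N' : MCell) (σ u f' v : Fin 4) : Prop :=
  ¬ isApex (Z σ) ∧ EncDir (Z σ) u ∧ UPartner Z q σ u ∧ (0 ≤ (Z σ).1 → (Z σ).1 - (q σ).1 ≤ cabs (Z σ)) ∧ f' ≠ σ ∧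
    UPartner N' q f' v ∧
    (∀ P ∈ C.upper, ∀ w : Fin 4, w ≠ u → ¬ UPartner Z P σ w) ∧
    (∀ P ∈ C.upper, UPartner Z P σ u → (P σ).1 ≤ (q σ).1) ∧
    (∀ P ∈ C.upper, ¬ UPartner q P σ u) ∧
    (∀ P ∈ C.upper, NullBelow (P f') (Z f') →
      (MAgree P Z f' ∨ ∃ g : Fin 4, g ≠ f' ∧ MAgree2 P Z f' g ∧ NullBelow (P g) (Z g)) →
        Z f' = ray (P f') v ((Z f').1 - (P f').1)) ∧
    (∀ P ∈ C.upper, (∀ g, g ≠ σ → g ≠ f' → P g = Z g) → OnULineBelowEq (P σ) (q σ) u →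
      ¬ ((Z f').1 < (P f').1 ∧ (P f').1 ≤ (N' f').1 ∧ P f' = ray (Z f') v ((P f').1 - (Z f').1)) ∧
        ¬ (Effective (bsub (N' f') (P f')) ∧ Spacelike (bsub (P f') (Z f'))))

/-- **THE `A2I` FAMILY IS CLOSED on `C`** (no clause of `gen_a2i_w` is violated). Decidable. -/
abbrev XresA2IClosed (C : MConfig) : Prop :=
  ∀ Z ∈ C.lower, ∀ q ∈ C.upper, ∀ N' ∈ C.lower, ∀ σ u f' v : Fin 4, ¬ XresA2IFires C Z q N' σ u f' v

/-- **`A2I−`-CLOSED** = the original-world family (E₋ columns). -/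
abbrev A2IMinusClosed (C : MConfig) : Prop := XresA2IClosed C

/-- **`A2I+`-CLOSED** = the dual-world family (E₊ columns; no guard there since `α < 0` on every charged dual letter). -/
abbrev A2IPlusClosed (C : MConfig) : Prop := XresA2IClosed (C.dual 0)

/-- `A2I+` of the dual is `A2I−`. -/
theorem a2iPlusClosed_dual (C : MConfig) : A2IPlusClosed (C.dual 0) ↔ A2IMinusClosed C := by
  rw [A2IPlusClosed, dual_dual]

/-! ## §4 The four families together -/

/-- the four instance families are all closed on `C` (`X−`, `X+`, `A2I−`, `A2I+`): with `RuleDMu4Closed C` (and `FC1Mu4Closed C`) this is the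
STATIC side of the attribution runs' `core_only` ∕ `full` variants; a LINE 5 `StaticH H C` keeps the conjuncts of `H` only. Decidable. -/
abbrev XresFourClosed (C : MConfig) : Prop := XMinusClosed C ∧ XPlusClosed C ∧ A2IMinusClosed C ∧ A2IPlusClosed C

/-! ## §5 Probes (`decide`; the predicates compute — NOT certificates about the cell's supports) -/

section Probes

set_option synthInstance.maxSize 8192 in
set_option synthInstance.maxHeartbeats 2000000 in -- the unfolded predicates are large decidable instances (as in `Pad4TowerRuleDMu4` §5)
/-- §22's instrumented column (`Pad4TowerCrossPhase.j275278Column`: `Z = [O|O|ℓ₋₁|6ℓ₋₁]`, its partner `q = [O|O|O|6ℓ₋₁]`, the sibling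
`n = [O|O|ℓ_{∓i}|6ℓ₋₁]`) FIRES `X−` (at `f = 0`: an `O`-factor admits no breaker), and is `X−`-closed once the sibling is removed. -/
theorem j275278Column_xres : ¬ XMinusClosed j275278Column ∧
    XMinusClosed ⟨{mcellOf (0,0,0) (0,0,0) (lpt 1 2) (lpt 6 2)}, {mcellOf (0,0,0) (0,0,0) (0,0,0) (lpt 6 2)}⟩ := by
  constructor <;> decide +kernel

set_option synthInstance.maxSize 8192 in
set_option synthInstance.maxHeartbeats 2000000 in -- as above
/-- s4-ref g72's witness W1 (`Pad4TowerCrossPhase.w1Witness`): the non-cone participant `P′ = [(0, 1−i)|O|O|O]` is an (H-e′) BREAKER of both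
columns, so W1 is `X−`-CLOSED; with `P′` removed the column `[ℓ₁|O|O|O]` fires (partner `[O|O|O|O]`, sibling `[ℓ_{i³}|O|O|O]`). -/
theorem w1Witness_xres : XMinusClosed w1Witness ∧
    ¬ XMinusClosed ⟨w1Witness.lower, {mcellOf (0,0,0) (0,0,0) (0,0,0) (0,0,0)}⟩ := by
  constructor <;> decide +kernel

set_option synthInstance.maxSize 8192 in
set_option synthInstance.maxHeartbeats 2000000 in -- as above
/-- the D_ML8 pattern of `Pad4TowerA2IMu4` (`Z = [O|ℓ₁|ℓ_{i³}|2I]`, its `ℓ₁`-cancellation `q`, the four `O`-servers of `q`) FIRES `A2I−`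
(head `Z`, `σ = 1`, `u = 0`, `f′ = 0`, any server direction: no escape is present). -/
theorem dml8Pattern_xres : ¬ A2IMinusClosed dml8Pattern := by
  decide +kernel

/-- `Z = [2I|ℓ₁|O|O]`: `σ = 1` carries `ℓ₁` (`u = 0`), `f′ = 0` carries the NODE `2I` (an apex letter WITH letters below it: below-partners
`Z(0 ↦ ℓ_w)` exist in all four directions). -/
def a1wZ : MCell := mcellOf (2, 0, 0) (lpt 1 0) (0, 0, 0) (0, 0, 0)

/-- its `ℓ₁`-cancellation `q = [2I|O|O|O]`. -/
def a1wQ : MCell := mcellOf (2, 0, 0) (0, 0, 0) (0, 0, 0) (0, 0, 0)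

/-- the server `N′ = q + n_{i²}^{(0)} = [T_{i²}|O|O|O]` of `q` on `f′ = 0` in direction `v = 2` (`T = 2I + ℓ`). -/
def a1wN : MCell := mcellOf (ray (2, 0, 0) 2 1) (0, 0, 0) (0, 0, 0) (0, 0, 0)

/-- the below-partner `Z(0 ↦ ℓ₁) = [ℓ₁|ℓ₁|O|O]` of `Z` on `f′ = 0`: its `f′`-direction (`2I = ℓ₁ + n_{i²}`) IS the server's `v = 2` —
NOT an escape of `Z`'s instance under `A1W`; it is, however, the (3b) polluter of `N′`'s OWN instance (head `N′ = [T_{i²}|O|O|O]`, `u = 2`,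
partner `q`, server `Z` on factor `1` in direction `0`: `σ`-letter `ℓ₁ = q₀ − n_{i²}` on the `u`-line below `q₀ = 2I`, factor-`1` letter
`ℓ₁ = O + n_{i⁰}` null-lifted up to the server). -/
def a1wPsame : MCell := mcellOf (lpt 1 0) (lpt 1 0) (0, 0, 0) (0, 0, 0)

/-- the below-partner `Z(0 ↦ ℓ_i) = [ℓ_i|ℓ₁|O|O]`: its `f′`-direction is `n_{i³}` (`2I = ℓ_i + n_{i³}`), `3 ≠ v` — an escape of `Z`'s
instance under `A1W`; not on `N′`'s `u`-line, so no polluter for `N′`'s instance. -/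
def a1wPother : MCell := mcellOf (lpt 1 1) (lpt 1 0) (0, 0, 0) (0, 0, 0)

/-- `Z`, `N′` over `q` and both below-partners. -/
def a1wCfg : MConfig := ⟨{a1wZ, a1wN}, {a1wQ, a1wPsame, a1wPother}⟩

/-- the same without the other-direction below-partner. -/
def a1wCfgSame : MConfig := ⟨{a1wZ, a1wN}, {a1wQ, a1wPsame}⟩

/-- the same without the same-direction below-partner. -/
def a1wCfgOther : MConfig := ⟨{a1wZ, a1wN}, {a1wQ, a1wPother}⟩

set_option synthInstance.maxSize 8192 in
set_option synthInstance.maxHeartbeats 2000000 in -- as above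
/-- **the `A1W` subtlety computes as in the encoder**: with both below-partners present the configuration is `A2I−`-CLOSED (head `Z`'s
instance over the server `N′` is escaped by the OTHER-direction below-partner; head `N′`'s instance over the server `Z` is escaped by the
(3b) polluter `[ℓ₁|ℓ₁|O|O]`); dropping the other-direction partner lets `Z`'s instance fire (the same-direction one does not save); dropping
the same-direction partner lets `N′`'s instance fire. -/
theorem a1w_xres : A2IMinusClosed a1wCfg ∧ ¬ A2IMinusClosed a1wCfgSame ∧ ¬ A2IMinusClosed a1wCfgOther := by
  refine ⟨?_, ?_, ?_⟩ <;> decide +kernel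

set_option synthInstance.maxSize 8192 in
set_option synthInstance.maxHeartbeats 2000000 in -- as above
/-- the dual computes: `X+` of the dual of W1 is `X−` of W1 (closed), and `A2I+` of the dual of the D_ML8 pattern fires. -/
theorem dual_xres : XPlusClosed (w1Witness.dual 0) ∧ ¬ A2IPlusClosed (dml8Pattern.dual 0) := by
  constructor <;> decide +kernel

/-- CROSS-CHECK SAMPLE (seed 23 ∕ 0, verbatim from `driver.py`): `N = {[O|T_i|O|T_i]}`, `P = {[O|ℓ_{−i}|O|T_i], [O|2ℓ_i|O|T_i], [O|T_i|2ℓ_{−i}|T_i]}`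
(`T_u = 2I + ℓ_u`); the encoder's check-mode verdicts: `X−` closed, **`X+` FIRES**, `A2I−` closed, `A2I+` closed. -/
def xcSampleXPlus : MConfig :=
  ⟨{mcellOf (0, 0, 0) (3, 0, -1) (0, 0, 0) (3, 0, -1)},
   {mcellOf (0, 0, 0) (1, 0, 1) (0, 0, 0) (3, 0, -1), mcellOf (0, 0, 0) (2, 0, -2) (0, 0, 0) (3, 0, -1),
    mcellOf (0, 0, 0) (3, 0, -1) (2, 0, 2) (3, 0, -1)}⟩

/-- CROSS-CHECK SAMPLE (seed 23 ∕ 6): `N = {[O|T_{−i}|2ℓ₁|T_i]}`, `P = {[O|ℓ_i|2ℓ₁|T_i], [O|T_{−i}|ℓ₁|T_i]}`; the encoder's verdicts: `X−` closed,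
`X+` closed, `A2I−` closed, **`A2I+` FIRES**. -/
def xcSampleA2IPlus : MConfig :=
  ⟨{mcellOf (0, 0, 0) (3, 0, 1) (2, 2, 0) (3, 0, -1)},
   {mcellOf (0, 0, 0) (1, 0, -1) (2, 2, 0) (3, 0, -1), mcellOf (0, 0, 0) (3, 0, 1) (1, 1, 0) (3, 0, -1)}⟩

set_option synthInstance.maxSize 8192 in
set_option synthInstance.maxHeartbeats 2000000 in -- as above
/-- the two shipped cross-check samples reproduce the encoder's verdicts (2 × 4 of the 160 agreeing verdicts). [kernel, `decide`] -/
theorem xcSamples_xres :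
    (XMinusClosed xcSampleXPlus ∧ ¬ XPlusClosed xcSampleXPlus ∧ A2IMinusClosed xcSampleXPlus ∧ A2IPlusClosed xcSampleXPlus) ∧
    (XMinusClosed xcSampleA2IPlus ∧ XPlusClosed xcSampleA2IPlus ∧ A2IMinusClosed xcSampleA2IPlus ∧ ¬ A2IPlusClosed xcSampleA2IPlus) := by
  refine ⟨⟨?_, ?_, ?_, ?_⟩, ⟨?_, ?_, ?_, ?_⟩⟩ <;> decide +kernel

end Probes

end Summit.Ventures.HSemireg.Pad4Tower
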